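import Literature.AlgebraicGeometry.RealAlgebraic.ComplexOrientationFormulaGroundwork
import Literature.AlgebraicGeometry.RealAlgebraic.PlaneCurveLocalCharts
import HarnessLib

/-!
# Rokhlin's complex orientation formula: algebraic lemmas for the assembly

Sibling proof file of `ComplexOrientationFormula.lean` (topic
`Literature/AlgebraicGeometry/RealAlgebraic`). Everything here is PROVED; no definition and no
named fact is introduced. Small inputs of the final assembly of the proof of
`rokhlin_sum_sign_mul_area_ovalInterior_mem_algebraic_mul_pi`:

* `irreducible_map_normalisedShear` — the normalised sheared polynomial
  `Q = a⁻¹ p(ξ + cY, Y) ∈ ℚ[ξ][Y]` of a geometrically irreducible `p` is irreducible over `ℂ`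
  (the shear is an automorphism of `ℂ[x, y] ≅ ℂ[ξ][Y]`);
* `eval_map_normalisedShear_eq_zero_iff` — its fibre roots over `ξ` are the `y` with
  `p(ξ + cy, y) = 0`;
* `eval_derivative_map_shear` — `∂_Y p(ξ + cY, Y)|_{Y=y} = c ∂ₓp + ∂_y p` at `(ξ + cy, y)`
  (chain rule and uniqueness of derivatives);
* `complexOrientationSignAt_eq_of_ne_zero` — a non-zero `complexOrientationSign` is the pointwise
  sign at every point of the oval;
* `isAlgebraic_im` — the imaginary part of an algebraic number is algebraic;
* `eq_of_eventually_sum_rpow_mul_eq` — uniqueness of divergent expansions indexed by an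
  arbitrary finite set of exponents (regrouping of `eq_zero_of_eventually_sum_rpow_smul_eq`).

[folklore]

## References

* V. A. Rokhlin, Complex orientations of real algebraic curves, Funct. Anal. Appl. 8 (1974)
  331–334. [Rokhlin1974]
-/

noncomputable section

open MvPolynomial Set Filter
open scoped _root_.Topology

namespace Literature.AlgebraicGeometry.RealAlgebraic

namespace Assembly

/-! ### The shear is an automorphism: irreducibility of the normalised sheared polynomial -/

/-- Base change commutes with the shear substitution `x ↦ ξ + cY`, `y ↦ Y`. [folklore] -/
theorem map_aeval_shear (c : ℚ) (p : MvPolynomial (Fin 2) ℚ) :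
    (aeval (![Polynomial.C Polynomial.X + Polynomial.C (Polynomial.C c) * Polynomial.X, Polynomial.X] :
        Fin 2 → Polynomial (Polynomial ℚ)) p).map (Polynomial.mapRingHom (algebraMap ℚ ℂ)) =
      aeval (![Polynomial.C Polynomial.X + Polynomial.C (Polynomial.C (c : ℂ)) * Polynomial.X, Polynomial.X] :
        Fin 2 → Polynomial (Polynomial ℂ)) (map (algebraMap ℚ ℂ) p) := by
  have key : (Polynomial.mapRingHom (Polynomial.mapRingHom (algebraMap ℚ ℂ))).comp
      (aeval (![Polynomial.C Polynomial.X + Polynomial.C (Polynomial.C c) * Polynomial.X, Polynomial.X] :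
        Fin 2 → Polynomial (Polynomial ℚ))).toRingHom =
      (aeval (![Polynomial.C Polynomial.X + Polynomial.C (Polynomial.C (c : ℂ)) * Polynomial.X,
        Polynomial.X] : Fin 2 → Polynomial (Polynomial ℂ))).toRingHom.comp (map (algebraMap ℚ ℂ)) := by
    refine MvPolynomial.ringHom_ext (fun r => ?_) (fun i => ?_)
    · simp [Polynomial.map_C]
    · fin_cases i <;> simp [Polynomial.map_C]
  exact RingHom.congr_fun key p

/-- **The shear is a ring automorphism**: `p ↦ p(ξ + cY, Y)` is bijective from `K[x, y]` onto
`K[ξ][Y]` (inverse `ξ ↦ x - c y`, `Y ↦ y`), hence preserves irreducibility. [folklore] -/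
theorem irreducible_aeval_shear_iff {K : Type*} [Field K] (c : K) (p : MvPolynomial (Fin 2) K) :
    Irreducible (aeval (![Polynomial.C Polynomial.X + Polynomial.C (Polynomial.C c) * Polynomial.X,
      Polynomial.X] : Fin 2 → Polynomial (Polynomial K)) p) ↔ Irreducible p := by
  set S : MvPolynomial (Fin 2) K →ₐ[K] Polynomial (Polynomial K) :=
    aeval (![Polynomial.C Polynomial.X + Polynomial.C (Polynomial.C c) * Polynomial.X, Polynomial.X] :
      Fin 2 → Polynomial (Polynomial K)) with hS
  set T : Polynomial (Polynomial K) →ₐ[K] MvPolynomial (Fin 2) K :=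
    Polynomial.aevalTower (Polynomial.aeval (X 0 - C c * X 1) : Polynomial K →ₐ[K] MvPolynomial (Fin 2) K)
      (X 1) with hT
  have hTS : T.comp S = AlgHom.id K _ := by
    refine MvPolynomial.algHom_ext fun i => ?_
    fin_cases i
    · simp [hS, hT, Polynomial.aevalTower_C]
    · simp [hS, hT, Polynomial.aevalTower_X]
  have hST : S.comp T = AlgHom.id K _ := by
    refine Polynomial.algHom_ext' (Polynomial.algHom_ext ?_) ?_
    · simp [hS, hT, Polynomial.aevalTower_C]
    · simp [hS, hT, Polynomial.aevalTower_X]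
  set e : MvPolynomial (Fin 2) K ≃ₐ[K] Polynomial (Polynomial K) :=
    AlgEquiv.ofAlgHom S T hST hTS with he
  have : S p = e p := rfl
  rw [this]
  exact MulEquiv.irreducible_iff (e : MvPolynomial (Fin 2) K ≃* Polynomial (Polynomial K))

/-- **The normalised sheared polynomial is irreducible over `ℂ`** when `p` is geometrically
irreducible. [folklore] -/
theorem irreducible_map_normalisedShear {p : MvPolynomial (Fin 2) ℚ}
    (hirr : Irreducible (map (algebraMap ℚ ℂ) p)) (c : ℚ) {a : ℚ} (ha : a ≠ 0) :
    Irreducible ((Polynomial.C (Polynomial.C a⁻¹) *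
      aeval (![Polynomial.C Polynomial.X + Polynomial.C (Polynomial.C c) * Polynomial.X, Polynomial.X] :
        Fin 2 → Polynomial (Polynomial ℚ)) p).map (Polynomial.mapRingHom (algebraMap ℚ ℂ))) := by
  rw [Polynomial.map_mul, Polynomial.map_C, map_aeval_shear]
  have hunit : IsUnit (Polynomial.C (Polynomial.mapRingHom (algebraMap ℚ ℂ) (Polynomial.C a⁻¹)) :
      Polynomial (Polynomial ℂ)) := by
    rw [Polynomial.coe_mapRingHom, Polynomial.map_C]
    exact Polynomial.isUnit_C.2 (Polynomial.isUnit_C.2 (IsUnit.mk0 _ (by simpa using ha)))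
  rw [irreducible_isUnit_mul hunit, irreducible_aeval_shear_iff]
  exact hirr

/-! ### Fibre roots of the normalised sheared polynomial -/

/-- **Fibre roots are curve points on the sheared line**:
`(a⁻¹ p(ξ + cY, Y))(y) = 0 ↔ p(ξ + cy, y) = 0`. [folklore] -/
theorem eval_map_normalisedShear_eq_zero_iff {p : MvPolynomial (Fin 2) ℚ} (c : ℚ) {a : ℚ} (ha : a ≠ 0)
    (ξ y : ℂ) :
    ((Polynomial.C (Polynomial.C a⁻¹) *
      aeval (![Polynomial.C Polynomial.X + Polynomial.C (Polynomial.C c) * Polynomial.X, Polynomial.X] :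
        Fin 2 → Polynomial (Polynomial ℚ)) p).map (Polynomial.eval₂RingHom (algebraMap ℚ ℂ) ξ)).eval y = 0 ↔
      aeval (![ξ + (c : ℂ) * y, y] : Fin 2 → ℂ) p = 0 := by
  have h := ShearMonic.aevalTower_aeval_shear (A := ℂ) c p ξ y
  rw [Polynomial.map_mul, Polynomial.map_C, Polynomial.eval_mul, Polynomial.eval_C, mul_eq_zero]
  have ha' : (Polynomial.eval₂RingHom (algebraMap ℚ ℂ) ξ) (Polynomial.C a⁻¹) ≠ 0 := by
    simpa using ha
  rw [or_iff_right ha']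
  have heval : ((aeval (![Polynomial.C Polynomial.X + Polynomial.C (Polynomial.C c) * Polynomial.X,
      Polynomial.X] : Fin 2 → Polynomial (Polynomial ℚ)) p).map
        (Polynomial.eval₂RingHom (algebraMap ℚ ℂ) ξ)).eval y =
      Polynomial.aevalTower (Polynomial.aeval ξ) y
        (aeval (![Polynomial.C Polynomial.X + Polynomial.C (Polynomial.C c) * Polynomial.X,
          Polynomial.X] : Fin 2 → Polynomial (Polynomial ℚ)) p) := by
    rw [Polynomial.eval_map]
    rfl
  rw [heval, h]
  simp

/-! ### The `Y`-derivative of the sheared polynomial -/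

/-- **Chain rule along the sheared line**: for the fibre `f(Y) = p(ξ + cY, Y)` over `ξ`,
`f'(y) = c ∂ₓp(v) + ∂_y p(v)`, `v = (ξ + cy, y)`. [folklore] -/
theorem eval_derivative_map_shear {p : MvPolynomial (Fin 2) ℚ} (c : ℚ) (ξ y : ℂ) :
    (Polynomial.derivative ((aeval (![Polynomial.C Polynomial.X + Polynomial.C (Polynomial.C c) *
        Polynomial.X, Polynomial.X] : Fin 2 → Polynomial (Polynomial ℚ)) p).map
      (Polynomial.eval₂RingHom (algebraMap ℚ ℂ) ξ))).eval y =
      (c : ℂ) * aeval (![ξ + (c : ℂ) * y, y] : Fin 2 → ℂ) (pderiv 0 p) +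
        aeval (![ξ + (c : ℂ) * y, y] : Fin 2 → ℂ) (pderiv 1 p) := by
  set f : Polynomial ℂ := (aeval (![Polynomial.C Polynomial.X + Polynomial.C (Polynomial.C c) *
      Polynomial.X, Polynomial.X] : Fin 2 → Polynomial (Polynomial ℚ)) p).map
    (Polynomial.eval₂RingHom (algebraMap ℚ ℂ) ξ) with hf
  -- the fibre as a composite `t ↦ p_ℂ(L t)`, `L t = (ξ + ct, t)`
  set pC : MvPolynomial (Fin 2) ℂ := map (algebraMap ℚ ℂ) p with hpC
  set L : ℂ → Fin 2 → ℂ := fun t => ![ξ + (c : ℂ) * t, t] with hL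
  have hfeval : ∀ t : ℂ, f.eval t = eval (L t) pC := by
    intro t
    have h := ShearMonic.aevalTower_aeval_shear (A := ℂ) c p ξ t
    rw [hf, Polynomial.eval_map, hpC, ← aeval_eq_eval_mapC]
    have : Polynomial.aevalTower (Polynomial.aeval ξ) t
        (aeval (![Polynomial.C Polynomial.X + Polynomial.C (Polynomial.C c) * Polynomial.X,
          Polynomial.X] : Fin 2 → Polynomial (Polynomial ℚ)) p) =
        Polynomial.eval₂ (Polynomial.eval₂RingHom (algebraMap ℚ ℂ) ξ) t
          (aeval (![Polynomial.C Polynomial.X + Polynomial.C (Polynomial.C c) * Polynomial.X,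
            Polynomial.X] : Fin 2 → Polynomial (Polynomial ℚ)) p) := rfl
    rw [← this, h]
    simp [hL]
  have h1 : HasDerivAt (fun t => f.eval t) ((Polynomial.derivative f).eval y) y := Polynomial.hasDerivAt f y
  have hLd : HasDerivAt L (![(c : ℂ), 1] : Fin 2 → ℂ) y := by
    have hLfun : L = fun t => (![ξ, 0] : Fin 2 → ℂ) + t • (![(c : ℂ), 1] : Fin 2 → ℂ) := by
      funext t
      ext i
      fin_cases i <;> simp [hL, mul_comm]
    have h := ((hasDerivAt_id y).smul_const (![(c : ℂ), 1] : Fin 2 → ℂ)).const_add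
      (![ξ, 0] : Fin 2 → ℂ)
    rw [one_smul] at h
    rw [hLfun]
    exact h
  have h2 := (Literature.NumberTheory.Transcendental.hasFDerivAt_eval pC (L y)).comp_hasDerivAt y hLd
  have h2' : HasDerivAt (fun t => f.eval t)
      ((∑ i, eval (L y) (pderiv i pC) • (ContinuousLinearMap.proj i : (Fin 2 → ℂ) →L[ℂ] ℂ))
        (![(c : ℂ), 1] : Fin 2 → ℂ)) y := by
    have : (fun t => f.eval t) = (fun w => eval w pC) ∘ L := funext fun t => hfeval t
    rw [this]
    exact h2
  have huniq := h1.unique h2'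
  rw [huniq]
  have happ : ∀ z : Fin 2 → ℂ,
      (∑ i, eval (L y) (pderiv i pC) • (ContinuousLinearMap.proj i : (Fin 2 → ℂ) →L[ℂ] ℂ)) z =
        ∑ i, eval (L y) (pderiv i pC) * z i := fun z => by simp
  rw [happ, Fin.sum_univ_two]
  have hpd : ∀ i, eval (L y) (pderiv i pC) = aeval (![ξ + (c : ℂ) * y, y] : Fin 2 → ℂ) (pderiv i p) := by
    intro i
    rw [hpC, pderiv_map, ← aeval_eq_eval_mapC]
  rw [hpd, hpd]
  simp
  ring

/-! ### A non-zero oval sign is the pointwise sign everywhere on the oval -/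

/-- If `complexOrientationSign p H O ≠ 0` then it equals `complexOrientationSignAt p H O v` at
every `v ∈ O` (by definition the sign is the common value of the constant pointwise sign).
[folklore] -/
theorem complexOrientationSignAt_eq_of_ne_zero {R : Type*} [CommSemiring R] [Algebra R ℂ]
    (p : MvPolynomial (Fin 2) R) {H : Set (Fin 2 → ℂ)} {O : Set (Fin 2 → ℝ)}
    (h : complexOrientationSign p H O ≠ 0) {v : Fin 2 → ℝ} (hv : v ∈ O) :
    complexOrientationSignAt p H O v = complexOrientationSign p H O := by
  classical
  unfold complexOrientationSign at h ⊢
  split_ifs at h ⊢ with hc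
  · exact hc.2 v hv _ hc.1.some_mem
  · exact absurd rfl h

/-! ### Imaginary parts of algebraic numbers -/

/-- The complex conjugate of an algebraic number is algebraic. [folklore] -/
theorem isAlgebraic_conj {z : ℂ} (hz : IsAlgebraic ℚ z) : IsAlgebraic ℚ (starRingEnd ℂ z) := by
  have h := hz.algHom ((Complex.conjAe.toAlgHom).restrictScalars ℚ)
  simpa using h

/-- **The imaginary part of an algebraic number is a real algebraic number.** [folklore] -/
theorem isAlgebraic_im {z : ℂ} (hz : IsAlgebraic ℚ z) : IsAlgebraic ℚ z.im := by
  -- `i` is algebraic (as in `KoblitzOgus.isAlgebraic_I`, inlined to keep the imports light)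
  have hI : IsAlgebraic ℚ Complex.I :=
    IsAlgebraic.of_pow two_pos (by rw [Complex.I_sq]; exact isAlgebraic_one.neg)
  have h2I : IsAlgebraic ℚ ((2 : ℂ) * Complex.I)⁻¹ :=
    ((isAlgebraic_algebraMap (2 : ℚ)).mul hI |>.inv) |> fun h => by simpa using h
  have hC : IsAlgebraic ℚ ((z - starRingEnd ℂ z) * ((2 : ℂ) * Complex.I)⁻¹) :=
    (hz.sub (isAlgebraic_conj hz)).mul h2I
  have heq : (z - starRingEnd ℂ z) * ((2 : ℂ) * Complex.I)⁻¹ = ((z.im : ℝ) : ℂ) := by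
    rw [Complex.sub_conj]
    refine (mul_inv_eq_iff_eq_mul₀ (by simp : (2 : ℂ) * Complex.I ≠ 0)).2 ?_
    push_cast
    ring
  rw [heq] at hC
  exact (isAlgebraic_algebraMap_iff (R := ℚ) (A := ℂ) Complex.ofReal_injective).1 hC

/-! ### Uniqueness of divergent expansions, indexed form -/

/-- **Uniqueness of a divergent asymptotic expansion** (indexed form): if
`Σ_{i ∈ s} cᵢ R^{eᵢ} + C + g(R)` (`eᵢ > 0`, `g → 0`) is eventually equal to the constant `L`, then
`L = C`. [folklore] -/
theorem eq_of_eventually_sum_rpow_mul_eq {ι : Type*} (s : Finset ι) (e : ι → ℝ)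
    (hpos : ∀ i ∈ s, 0 < e i) (c : ι → ℝ) (C L : ℝ) (g : ℝ → ℝ) (hg : Tendsto g atTop (𝓝 0))
    (h : ∀ᶠ R in atTop, ∑ i ∈ s, R ^ (e i) * c i + C + g R = L) : L = C := by
  classical
  obtain ⟨c', hc'⟩ : ∃ c' : ℝ → ℝ, ∀ q, c' q = ∑ i ∈ s with e i = q, c i := ⟨_, fun _ => rfl⟩
  have hregroup : ∀ R : ℝ, ∑ q ∈ s.image e, R ^ q • c' q = ∑ i ∈ s, R ^ (e i) * c i := by
    intro R
    simp only [hc', smul_eq_mul, Finset.mul_sum]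
    rw [← Finset.sum_fiberwise_of_maps_to (fun i hi => Finset.mem_image_of_mem e hi)
      (fun i => R ^ e i * c i)]
    refine Finset.sum_congr rfl fun q _ => Finset.sum_congr rfl fun i hi => ?_
    rw [(Finset.mem_filter.1 hi).2]
  have ht0 : ∀ q ∈ s.image e, 0 < q := by
    intro q hq
    obtain ⟨i, hi, rfl⟩ := Finset.mem_image.1 hq
    exact hpos i hi
  have h' : ∀ᶠ R in atTop, ∑ q ∈ s.image e, R ^ q • c' q + C + g R = L := by
    filter_upwards [h] with R hR
    rw [hregroup]
    exact hR
  exact (eq_zero_of_eventually_sum_rpow_smul_eq (s.image e) ht0 c' C L g hg h').2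

end Assembly

end Literature.AlgebraicGeometry.RealAlgebraic
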